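import Summits.QuantumFields.YangMills.Theorems.FluctuationComparisonRegPrIntLS2BetaCoarseCurlOfChartRead
import HarnessLib

/-!
# S2β · (CURL-AVG, FILE E) THE LOCAL EDITION: the dilution kernel of a coarse plaquette `p′` is supported in its FOUR CORNER BLOCKS, and the (CURL-AVG) row for `ψ_{U₀}(X)` holds with the
# LOCAL size `M_{p′} = max{‖X b‖ : B(b₋) a corner block of p′}` in place of the global `‖X‖` (px16 g22 17:41:19Z lane remark; px16 g22 17:49:04Z (i) «supp W(p′,·) ⊂ O(1) cells»)

Cell `ym3-torus` (YM ladder rung R3 = continuum `SU(2)` Yang–Mills on the three-torus at fixed lattice data — a RUNG: NOT d = 4, NOT infinite volume, NOT a mass gap,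
NOT Clay).  Width seat `ym3-torus-px13` (gen 26); crux `stmt-QuantumFields-20520`, LINE g18-1 S2β, pairing lane; (SCT-c) road of record (px16 g22 LOCATE 17:49:04Z, px17 g22
17:47:42Z): propagate relative curls with the TRUE one-step kernel of (CURL-AVG) B2 ✓p830155 ∕ C ✓p830200 and close with the cell-maximal square-function lemma (★); the kernel
facts wanted BY KERNEL are (a) `Σ_q W = L²` (the shape of B2's sum), (d) `supp W(p′,·) ⊂` the four corner blocks — THIS FILE — and (b)(c) max∕column sums (a counting file, next).
THIS FILE also types the lane's locality remark: the `max_{READ}` aggregation must see LOCAL sizes, and since `ψ` is not linear the truncation must happen BEFORE the second-order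
letter (β-3) — done here by applying C to the field truncated to the corner blocks and proving that nothing in C's right-hand side notices the truncation.
`--kind proof --supports stmt-QuantumFields-20520 --as helper`, count-neutral, DEFINITION-FREE; generic `P : Params` in the standing range `j + 1 ≤ m + K`, `SU(N)` and `SU(2)`.

NOTATION (written out in every signature).  Coarse plaquette `p′ = (y; μ, ν)`, `μ ≠ ν`; its CORNER BLOCKS `y, y+e_μ, y+e_ν, y+e_μ+e_ν`; «`b` is a corner bond» := `blockOf b₋` is a corner;
comb site `x_i = blockSite y r` (= `walkEnd (emb y) Γ^σ(n_r)`, lit ✓`walkEnd_emb_stairWord_eq_blockSite`); B2's plaquette `q_{i,s,t}` = the word `[ν⁺, μ̄, ν̄, μ⁺]` from `x_i + (s+1)e_μ + t e_ν`.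

WHAT IS PROVED (sorry-free).
* §1 site arithmetic: `unshift_shiftN_shiftN_succ`, `walkEnd_stair_replicate_eq_shiftN` (B2's base point `= shiftN (shiftN (blockSite y r) μ (s+1)) ν t`), `src_of_mem_walk_plaq'`
  (the four bond sources of the word `[ν⁺, μ̄, ν̄, μ⁺]` from `z`).
* §2 ★`blockOf_shiftN_shiftN_blockSite` — `blockOf (x_i + a e_μ + b e_ν)` is a corner block for `a, b ≤ L` (lit ✓`shiftN_blockSite_eq_of_le∕ge` twice); ★★`blockOf_src_mem_walk_plaq_corner` —
  EVERY BOND OF EVERY PLAQUETTE `q_{i,s,t}` OF B2's DILUTION TERM ISSUES FROM A CORNER BLOCK OF `p′` (kernel support, px16's (d)).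
* §3 `covWalkSum_plaq'_congr_of_corner` (the dilution term only reads corner bonds), `curl_chartRead_congr_of_corner` (the coarse curl of `ψ_{U₀}(A)` around `∂p′` only reads `A` on corner bonds —
  (D1-loc) ✓`chartRead_apply_local` at the four bonds of `∂p′`), `norm_truncCorner_le`.
* §4 ★★★`norm_curl_chartRead_le_local` (generic `N`, radius `ρ`) and ★★★`norm_curl_chartRead_le_local_SU2`: C ✓`norm_curl_chartRead_le(_SU2)` with `‖X‖` REPLACED BY ANY `M ≥ 0` bounding
  `‖X b‖` on the corner bonds of `p′` — the dilution term unchanged (it reads `X̂` itself).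

HONEST.  Lattice geometry ∕ bookkeeping over landed letters (C ✓p830200, (D1-loc) ✓`chartRead_apply_local`, lit block geometry); nothing of Bałaban's analysis asserted; the counting
facts (b)(c), (★), (SCT-c)∕(SCT), (ST), LOC ∕ `hLoc`, AVG₂♭-ax_q, GAP♯∘ (registry 3732b7df UNTOUCHED, 0∕5), the five REGISTERED stubs, S2β, crux 20520, 19936, 19200, `YM3TorusSU2` —
NOT proved; rung R3 = SU(2) YM₃ on T³ at fixed lattice data — NOT d = 4, NOT infinite volume, NOT a mass gap, NOT Clay; the Yang–Mills mass gap is NOT proved.  Axioms standard.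

References: [Balaban1985Averaging] CMP **98** (1985) (9)–(10) p.19, (19)–(20) p.21, Prop. 1 (51) p.26, (58) p.27, Prop. 3 (124)–(126) p.36; [Balaban1987RG1] CMP **109** (1987)
(0.1)–(0.4) pp.252–253.
-/

set_option autoImplicit false

noncomputable section

open scoped Matrix.Norms.L2Operator BigOperators
open Finset

namespace Summit.QuantumFields.YangMills.Theorems.FluctuationComparisonRegPrIntLS2BetaCoarseCurlLocal

open Literature.MathematicalPhysics.QuantumFieldTheory.Balaban1983to89
open Literature.MathematicalPhysics.QuantumFieldTheory.Balaban1983to89.T4Continuum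
open Literature.MathematicalPhysics.QuantumFieldTheory.Balaban1983to89.HaarExponentialChart
open Literature.MathematicalPhysics.QuantumFieldTheory.Balaban1983to89.HaarExponentialChart.IsChartRep
open Literature.MathematicalPhysics.QuantumFieldTheory.Balaban1983to89.BlockAveraging (Idx avgFun loopHol off corr Small)
open Literature.MathematicalPhysics.QuantumFieldTheory.Balaban1983to89.ExpMeanLog (expMeanLogSU deltaSU)
open Literature.MathematicalPhysics.QuantumFieldTheory.Balaban1983to89.BlockAveragingEMLLinearised (stepFactor length_walk walkEnd_emb_stairWord_eq_blockSite)
open Literature.MathematicalPhysics.QuantumFieldTheory.Balaban1983to89.BlockAveragingEMLLinearisedBackground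
  (covStep covWalkSum covWalkSum_nil covWalkSum_cons covWalkSum_append covWalkSum_add covLinAvgR0 norm_covWalkSum_le)
open Literature.MathematicalPhysics.QuantumFieldTheory.Balaban1983to89.B10StarCount (shift_unshift unshift_shift)
open Literature.MathematicalPhysics.QuantumFieldTheory.Balaban1983to89.B10Eq47AxialChi (shiftN shiftN_succ shiftN_zero)
open Literature.MathematicalPhysics.QuantumFieldTheory.Balaban1983to89.BlockAveragingEMLProp2 (shift_shift_comm shiftN_apply walkEnd_replicate_true)
open Literature.MathematicalPhysics.QuantumFieldTheory.Balaban1983to89.B12B0LoopGeometry267 (shiftN_blockSite_eq_of_le shiftN_blockSite_eq_of_ge)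
open Literature.MathematicalPhysics.QuantumFieldTheory.Balaban1983to89.Node00
open Summit.QuantumFields.YangMills.Theorems.FluctuationComparisonRegPrIntLS2BetaChartReadDerivLocal (covWalkSum_congr chartRead_apply_local)
open Summit.QuantumFields.YangMills.Theorems.FluctuationComparisonRegPrIntLS2BetaCoarseCurlTransports (covWalkSum_walk_plaq_eq shift_shift_unshift)
open Summit.QuantumFields.YangMills.Theorems.FluctuationComparisonRegPrIntLS2BetaCoarseCurlOfChartRead (norm_curl_chartRead_le norm_curl_chartRead_le_SU2)

variable {P : Params} {j : ℕ} {N : ℕ} [NeZero N]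

/-! ## §1 Site arithmetic: the base point of B2's plaquettes and the four bond sources of the word `[ν⁺, μ̄, ν̄, μ⁺]` -/

section Sites

/-- `(x + (a+1)e_μ + c e_ν) − e_μ = x + a e_μ + c e_ν`. [folklore] -/
theorem unshift_shiftN_shiftN_succ {k : ℕ} (x : Site P k) (μ ν : Fin P.d) (a c : ℕ) :
    (shiftN (shiftN x μ (a + 1)) ν c).unshift μ = shiftN (shiftN x μ a) ν c := by
  funext κ
  simp only [Site.unshift_apply, shiftN_apply]
  by_cases hκμ : κ = μ
  · subst hκμ
    by_cases hκν : κ = ν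
    · subst hκν; simp only [if_true]; push_cast; ring
    · simp only [if_true, if_neg hκν]; push_cast; ring
  · simp only [if_neg hκμ]

/-- `(X + (c+1)e_ν) − e_ν = X + c e_ν`. [folklore] -/
theorem unshift_shiftN_succ {k : ℕ} (X : Site P k) (ν : Fin P.d) (c : ℕ) : (shiftN X ν (c + 1)).unshift ν = shiftN X ν c := by
  rw [shiftN_succ, unshift_shift]

/-- B2's base point: `walkEnd (walkEnd (emb y) Γ^σ(n_r)) (μ^{s+1} ν^t) = blockSite y r + (s+1)e_μ + t e_ν`. [cite: Balaban1987RG1, (0.3) p.252 (bookkeeping)] -/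
theorem walkEnd_stair_replicate_eq_shiftN (y : Site P (j + 1)) (σ : Equiv.Perm (Fin P.d)) (r : Fin P.d → Fin P.L) (μ ν : Fin P.d) (a t : ℕ) :
    walkEnd (walkEnd (emb y) (stairWord σ (off r))) (List.replicate a (μ, true) ++ List.replicate t (ν, true)) = shiftN (shiftN (Site.blockSite y r) μ a) ν t := by
  rw [walkEnd_emb_stairWord_eq_blockSite, walkEnd_append, walkEnd_replicate_true, walkEnd_replicate_true]

omit [NeZero N] in
/-- The four bond sources of the word `[ν⁺, μ̄, ν̄, μ⁺]` from `z`: `z`, `z + e_ν − e_μ`, `z − e_μ` (twice). [folklore] -/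
theorem src_of_mem_walk_plaq' {k : ℕ} (z : Site P k) (μ ν : Fin P.d) (st : LStep P k)
    (hst : st ∈ walk z [((ν, true) : Letter P.d), (μ, false), (ν, false), (μ, true)]) :
    st.bond.src = z ∨ st.bond.src = (z.shift ν).unshift μ ∨ st.bond.src = ((z.shift ν).unshift μ).unshift ν := by
  simp only [walk, List.mem_cons, List.mem_nil_iff, or_false] at hst
  rcases hst with rfl | rfl | rfl | rfl
  · exact Or.inl rfl
  · exact Or.inr (Or.inl rfl)
  · exact Or.inr (Or.inr rfl)
  · exact Or.inr (Or.inr rfl)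

end Sites

/-! ## §2 ★★ Block geometry: `x_i + a e_μ + b e_ν` (`a, b ≤ L`) lies in a corner block; hence so does every bond of every plaquette of B2's dilution term -/

section Blocks

/-- ★ **TWO BOUNDED SHIFTS OF A BLOCK SITE STAY IN THE FOUR CORNER BLOCKS**: for `x = blockSite y r`, `μ ≠ ν`, `a ≤ L`, `b ≤ L`, the block of `x + a e_μ + b e_ν` is one of
`y, y+e_μ, y+e_ν, y+e_μ+e_ν` (lit ✓`shiftN_blockSite_eq_of_le∕ge` in each direction). [cite: Balaban1987RG1, (0.1) p.252] -/
theorem blockOf_shiftN_shiftN_blockSite (hj : j + 1 ≤ P.m + P.K) (y : Site P (j + 1)) (r : Fin P.d → Fin P.L) {μ ν : Fin P.d} (hμν : μ ≠ ν) {a b : ℕ}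
    (ha : a ≤ P.L) (hb : b ≤ P.L) :
    blockOf (shiftN (shiftN (Site.blockSite y r) μ a) ν b) = y ∨ blockOf (shiftN (shiftN (Site.blockSite y r) μ a) ν b) = y.shift μ ∨
      blockOf (shiftN (shiftN (Site.blockSite y r) μ a) ν b) = y.shift ν ∨ blockOf (shiftN (shiftN (Site.blockSite y r) μ a) ν b) = (y.shift μ).shift ν := by
  have hL := P.hL.2
  have hrμ := (r μ).isLt
  have hrν := (r ν).isLt
  -- first shift: a block site of `y` or of `y + e_μ`, with the `ν`-offset unchanged
  have step1 : ∃ (y₁ : Site P (j + 1)) (r₁ : Fin P.d → Fin P.L), (y₁ = y ∨ y₁ = y.shift μ) ∧ shiftN (Site.blockSite y r) μ a = Site.blockSite y₁ r₁ ∧ r₁ ν = r ν := by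
    by_cases h : (r μ : ℕ) + a ≤ P.L - 1
    · exact ⟨y, _, Or.inl rfl, shiftN_blockSite_eq_of_le hj y r μ a h, by rw [Function.update_of_ne (Ne.symm hμν)]⟩
    · rw [not_le] at h
      have h' := shiftN_blockSite_eq_of_ge hj ⟨y, μ⟩ r a (show P.L ≤ (r μ : ℕ) + a by omega) (show (r μ : ℕ) + a ≤ 2 * P.L - 1 by omega)
      exact ⟨y.shift μ, _, Or.inr rfl, h', by dsimp only; rw [Function.update_of_ne (Ne.symm hμν)]⟩
  obtain ⟨y₁, r₁, hy₁, h1, hr₁⟩ := step1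
  have hr₁ν : (r₁ ν : ℕ) = r ν := by rw [hr₁]
  -- second shift: a block site of `y₁` or of `y₁ + e_ν`
  have step2 : blockOf (shiftN (Site.blockSite y₁ r₁) ν b) = y₁ ∨ blockOf (shiftN (Site.blockSite y₁ r₁) ν b) = y₁.shift ν := by
    by_cases h : (r₁ ν : ℕ) + b ≤ P.L - 1
    · left; rw [shiftN_blockSite_eq_of_le hj y₁ r₁ ν b h, Site.blockOf_blockSite hj]
    · right
      rw [not_le] at h
      have h' := shiftN_blockSite_eq_of_ge hj ⟨y₁, ν⟩ r₁ b (show P.L ≤ (r₁ ν : ℕ) + b by omega) (show (r₁ ν : ℕ) + b ≤ 2 * P.L - 1 by omega)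
      dsimp only at h'
      rw [h', Site.blockOf_blockSite hj]; rfl
  rw [h1]
  rcases hy₁ with rfl | rfl <;> rcases step2 with h2 | h2
  · exact Or.inl h2
  · exact Or.inr (Or.inr (Or.inl h2))
  · exact Or.inr (Or.inl h2)
  · exact Or.inr (Or.inr (Or.inr h2))

/-- ★★ **THE DILUTION KERNEL IS SUPPORTED IN THE CORNER BLOCKS**: every bond of the plaquette word `[ν⁺, μ̄, ν̄, μ⁺]` from `x_i + (s+1)e_μ + t e_ν` (`x_i = blockSite y r`, `s, t < L`, `μ ≠ ν`)
issues from one of the four corner blocks of `p′ = (y; μ, ν)`. [cite: Balaban1987RG1, (0.1)-(0.3) p.252; Balaban1985Averaging, (9) p.19] -/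
theorem blockOf_src_mem_walk_plaq_corner (hj : j + 1 ≤ P.m + P.K) (y : Site P (j + 1)) (r : Fin P.d → Fin P.L) {μ ν : Fin P.d} (hμν : μ ≠ ν) {s t : ℕ}
    (hs : s < P.L) (ht : t < P.L) (st : LStep P j)
    (hst : st ∈ walk (shiftN (shiftN (Site.blockSite y r) μ (s + 1)) ν t) [((ν, true) : Letter P.d), (μ, false), (ν, false), (μ, true)]) :
    blockOf st.bond.src = y ∨ blockOf st.bond.src = y.shift μ ∨ blockOf st.bond.src = y.shift ν ∨ blockOf st.bond.src = (y.shift μ).shift ν := by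
  have h2 : ((shiftN (shiftN (Site.blockSite y r) μ (s + 1)) ν t).shift ν).unshift μ = shiftN (shiftN (Site.blockSite y r) μ s) ν (t + 1) := by
    rw [← shiftN_succ, unshift_shiftN_shiftN_succ]
  have h3 : (((shiftN (shiftN (Site.blockSite y r) μ (s + 1)) ν t).shift ν).unshift μ).unshift ν = shiftN (shiftN (Site.blockSite y r) μ s) ν t := by
    rw [h2, unshift_shiftN_succ]
  rcases src_of_mem_walk_plaq' _ μ ν st hst with h | h | h
  · rw [h]; exact blockOf_shiftN_shiftN_blockSite hj y r hμν (by omega) ht.le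
  · rw [h, h2]; exact blockOf_shiftN_shiftN_blockSite hj y r hμν hs.le (by omega)
  · rw [h, h3]; exact blockOf_shiftN_shiftN_blockSite hj y r hμν hs.le ht.le

end Blocks

/-! ## §3 What the two sides of C read: the dilution term reads `X̂` on corner bonds only; the coarse curl of `ψ_{U₀}(A)` reads `A` on corner bonds only -/

section Reads

omit [NeZero N] in
/-- **THE DILUTION TERM READS CORNER BONDS ONLY**: two bond fields agreeing on the corner bonds of `p′` have the same linearised curls around every `q_{i,s,t}`. [cite: Balaban1985Averaging, (58) p.27, (9) p.19] -/
theorem covWalkSum_plaq'_congr_of_corner (hj : j + 1 ≤ P.m + P.K) (U₀ : GaugeField P j (SU N)) {Y Y' : PBond P j → Matrix (Fin N) (Fin N) ℂ} (y : Site P (j + 1))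
    {μ ν : Fin P.d} (hμν : μ ≠ ν)
    (h : ∀ b : PBond P j, (blockOf b.src = y ∨ blockOf b.src = y.shift μ ∨ blockOf b.src = y.shift ν ∨ blockOf b.src = (y.shift μ).shift ν) → Y b = Y' b)
    (i : Idx P) {s t : ℕ} (hs : s < P.L) (ht : t < P.L) :
    covWalkSum U₀ Y (walk (walkEnd (walkEnd (emb y) (stairWord i.2.1 (off i.1))) (List.replicate (s + 1) (μ, true) ++ List.replicate t (ν, true)))
        [((ν, true) : Letter P.d), (μ, false), (ν, false), (μ, true)]) =
      covWalkSum U₀ Y' (walk (walkEnd (walkEnd (emb y) (stairWord i.2.1 (off i.1))) (List.replicate (s + 1) (μ, true) ++ List.replicate t (ν, true)))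
        [((ν, true) : Letter P.d), (μ, false), (ν, false), (μ, true)]) := by
  rw [walkEnd_stair_replicate_eq_shiftN]
  exact covWalkSum_congr U₀ _ fun st hst => h st.bond (blockOf_src_mem_walk_plaq_corner hj y i.1 hμν hs ht st hst)

/-- **THE COARSE CURL OF `ψ_{U₀}(A)` AROUND `∂p′` READS `A` ON CORNER BONDS ONLY** ((D1-loc) ✓`chartRead_apply_local` at the four bonds of `∂p′`, whose blocks `B(c₋), B(c₊)` are corners).
[cite: Balaban1985Averaging, p.19, Prop. 3 (124)-(126) p.36] -/
theorem curl_chartRead_congr_of_corner (hj : j + 1 ≤ P.m + P.K) (U₀ : GaugeField P j (SU N)) {A A' : PBond P j → (specialUnitaryLogChart (Fin N)).lie} (y : Site P (j + 1))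
    (μ ν : Fin P.d)
    (h : ∀ b : PBond P j, (blockOf b.src = y ∨ blockOf b.src = y.shift μ ∨ blockOf b.src = y.shift ν ∨ blockOf b.src = (y.shift μ).shift ν) → A b = A' b) :
    covWalkSum (avgFun (expMeanLogSU (n := Fin N)) U₀)
        (fun c : PBond P (j + 1) => (((isChartRep_specialUnitaryGroup (n := Fin N)).logChart
            (avgFun (expMeanLogSU (n := Fin N)) (fun b => (isChartRep_specialUnitaryGroup (n := Fin N)).expChart (A b) * U₀ b) c *
              (avgFun (expMeanLogSU (n := Fin N)) U₀ c)⁻¹) : (specialUnitaryLogChart (Fin N)).lie) : Matrix (Fin N) (Fin N) ℂ))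
        (walk y [((μ, true) : Letter P.d), (ν, true), (μ, false), (ν, false)]) =
      covWalkSum (avgFun (expMeanLogSU (n := Fin N)) U₀)
        (fun c : PBond P (j + 1) => (((isChartRep_specialUnitaryGroup (n := Fin N)).logChart
            (avgFun (expMeanLogSU (n := Fin N)) (fun b => (isChartRep_specialUnitaryGroup (n := Fin N)).expChart (A' b) * U₀ b) c *
              (avgFun (expMeanLogSU (n := Fin N)) U₀ c)⁻¹) : (specialUnitaryLogChart (Fin N)).lie) : Matrix (Fin N) (Fin N) ℂ))
        (walk y [((μ, true) : Letter P.d), (ν, true), (μ, false), (ν, false)]) := by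
  have h₁ := chartRead_apply_local hj U₀ (A := A) (A' := A') ⟨y, μ⟩ (fun b hb => h b (by
    rcases hb with hb | hb
    · exact Or.inl hb
    · exact Or.inr (Or.inl hb)))
  have h₂ := chartRead_apply_local hj U₀ (A := A) (A' := A') ⟨y.shift μ, ν⟩ (fun b hb => h b (by
    rcases hb with hb | hb
    · exact Or.inr (Or.inl hb)
    · exact Or.inr (Or.inr (Or.inr hb))))
  have h₃ := chartRead_apply_local hj U₀ (A := A) (A' := A') ⟨y.shift ν, μ⟩ (fun b hb => h b (by
    rcases hb with hb | hb
    · exact Or.inr (Or.inr (Or.inl hb))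
    · refine Or.inr (Or.inr (Or.inr ?_)); rw [hb]; exact (shift_shift_comm y μ ν).symm))
  have h₄ := chartRead_apply_local hj U₀ (A := A) (A' := A') ⟨y, ν⟩ (fun b hb => h b (by
    rcases hb with hb | hb
    · exact Or.inl hb
    · exact Or.inr (Or.inr (Or.inl hb))))
  rw [covWalkSum_walk_plaq_eq, covWalkSum_walk_plaq_eq, h₁, h₂, h₃, h₄]

/-- The corner truncation of `X` has sup norm at most any common bound `M ≥ 0` of `‖X b‖` on the corner bonds. [folklore] -/
theorem norm_truncCorner_le {X : PBond P j → (specialUnitaryLogChart (Fin N)).lie} {S : PBond P j → Prop} [DecidablePred S] {M : ℝ} (hM : 0 ≤ M)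
    (hX : ∀ b, S b → ‖X b‖ ≤ M) : ‖(fun b => if S b then X b else 0)‖ ≤ M := by
  refine (pi_norm_le_iff_of_nonneg hM).2 fun b => ?_
  by_cases hb : S b
  · simp only [hb, if_true]; exact hX b hb
  · simp only [hb, if_false, norm_zero]; exact hM

end Reads

/-! ## §4 ★★★ The local editions of (CURL-AVG) for `ψ_{U₀}(X)` -/

section Local

/-- ★★★ **(CURL-AVG) FOR `ψ_{U₀}(X)`, LOCAL EDITION (generic `N`)**: C ✓`norm_curl_chartRead_le` with the global `‖X‖` replaced by ANY `M ≥ 0` bounding `‖X b‖` on the bonds issuing from the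
four corner blocks `y, y+e_μ, y+e_ν, y+e_μ+e_ν` of `p′ = (y; μ, ν)` (`μ ≠ ν`, standing range `j+1 ≤ m+K`); the dilution term is unchanged. (Apply C to the corner truncation `X′` of `X`:
`‖X′‖ ≤ M`, the coarse curl and the dilution term do not notice the truncation, §2–§3.) [cite: Balaban1985Averaging, Prop. 1 (51) p.26, Prop. 3 (121)-(126) p.36; Balaban1987RG1, (0.4), (0.8) p.253] -/
theorem norm_curl_chartRead_le_local (hj : j + 1 ≤ P.m + P.K) (U₀ : GaugeField P j (SU N)) {α ρ : ℝ} (hρ0 : 0 < ρ) (hρ : ρ ≤ innerRadius (specialUnitaryLogChart (Fin N)))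
    (hα : ∀ (c : PBond P (j + 1)) (i : Idx P), dist1 (loopHol U₀ c i) ≤ α) (hα4 : 4 * α ≤ ρ) (hα24 : α ≤ 1 / 24) (hαδ : α < deltaSU (Fin N)) {δ : ℝ} (hδ : 0 ≤ δ)
    (hU : PlaqSmall δ U₀) (y : Site P (j + 1)) {μ ν : Fin P.d} (hμν : μ ≠ ν) {αp : ℝ}
    (hαp : dist1 (holAt (avgFun (expMeanLogSU (n := Fin N)) U₀) (walk y [((μ, true) : Letter P.d), (ν, true), (μ, false), (ν, false)])) ≤ αp)
    (X : PBond P j → (specialUnitaryLogChart (Fin N)).lie) {M : ℝ} (hM : 0 ≤ M)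
    (hXM : ∀ b : PBond P j, (blockOf b.src = y ∨ blockOf b.src = y.shift μ ∨ blockOf b.src = y.shift ν ∨ blockOf b.src = (y.shift μ).shift ν) → ‖X b‖ ≤ M) :
    ‖covWalkSum (avgFun (expMeanLogSU (n := Fin N)) U₀)
        (fun c : PBond P (j + 1) => (((isChartRep_specialUnitaryGroup (n := Fin N)).logChart
            (avgFun (expMeanLogSU (n := Fin N)) (fun b => (isChartRep_specialUnitaryGroup (n := Fin N)).expChart (X b) * U₀ b) c *
              (avgFun (expMeanLogSU (n := Fin N)) U₀ c)⁻¹) : (specialUnitaryLogChart (Fin N)).lie) : Matrix (Fin N) (Fin N) ℂ))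
        (walk y [((μ, true) : Letter P.d), (ν, true), (μ, false), (ν, false)])‖ ≤
      (Fintype.card (Idx P) : ℝ)⁻¹ * ∑ i : Idx P, ∑ s ∈ Finset.range P.L, ∑ t ∈ Finset.range P.L,
          ‖covWalkSum U₀ (fun b => ((X b : (specialUnitaryLogChart (Fin N)).lie) : Matrix (Fin N) (Fin N) ℂ))
            (walk (walkEnd (walkEnd (emb y) (stairWord i.2.1 (off i.1))) (List.replicate (s + 1) (μ, true) ++ List.replicate t (ν, true)))
            [((ν, true) : Letter P.d), (μ, false), (ν, false), (μ, true)])‖ +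
        (P.L : ℝ) * ((P.L : ℝ) * (2 * δ * ((P.L : ℝ) + 2 * P.L + 2) * M)) + 48 * α * ((P.L : ℝ) * M) +
        (2 * αp * ((((P.d + 2) * P.L : ℕ) : ℝ) * M) + 24 * α * ((((P.d + 2) * P.L : ℕ) : ℝ) * M)) +
        4 * (404 * (((P.d + 2) * P.L : ℕ) : ℝ) * α * M) + 4 * ((448000 / ρ ^ 2 + 172800 / ρ) * (((P.d + 2) * P.L : ℕ) : ℝ) ^ 2 * M ^ 2) := by
  classical
  -- the corner truncation
  set X' : PBond P j → (specialUnitaryLogChart (Fin N)).lie := fun b =>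
    if (blockOf b.src = y ∨ blockOf b.src = y.shift μ ∨ blockOf b.src = y.shift ν ∨ blockOf b.src = (y.shift μ).shift ν) then X b else 0 with hX'
  have hagree : ∀ b : PBond P j, (blockOf b.src = y ∨ blockOf b.src = y.shift μ ∨ blockOf b.src = y.shift ν ∨ blockOf b.src = (y.shift μ).shift ν) → X b = X' b := by
    intro b hb; simp only [hX', hb, if_true]
  have hagree' : ∀ b : PBond P j, (blockOf b.src = y ∨ blockOf b.src = y.shift μ ∨ blockOf b.src = y.shift ν ∨ blockOf b.src = (y.shift μ).shift ν) →
      (fun b => ((X' b : (specialUnitaryLogChart (Fin N)).lie) : Matrix (Fin N) (Fin N) ℂ)) b = (fun b => ((X b : (specialUnitaryLogChart (Fin N)).lie) : Matrix (Fin N) (Fin N) ℂ)) b := by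
    intro b hb; simp only [← hagree b hb]
  have hnorm : ‖X'‖ ≤ M := norm_truncCorner_le hM hXM
  have hα0 : 0 ≤ α := (GaugeGroup.dist1_nonneg _).trans (hα ⟨y, μ⟩ (Classical.arbitrary _))
  have hαp0 : 0 ≤ αp := (GaugeGroup.dist1_nonneg _).trans hαp
  -- C for the truncated field
  have hC := norm_curl_chartRead_le U₀ hρ0 hρ hα hα4 hα24 hαδ hδ hU y μ ν hαp X'
  -- neither side notices the truncation
  rw [← curl_chartRead_congr_of_corner hj U₀ (A := X) (A' := X') y μ ν hagree] at hC
  have hdil : ∀ i ∈ (Finset.univ : Finset (Idx P)), ∑ s ∈ Finset.range P.L, ∑ t ∈ Finset.range P.L,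
        ‖covWalkSum U₀ (fun b => ((X' b : (specialUnitaryLogChart (Fin N)).lie) : Matrix (Fin N) (Fin N) ℂ))
          (walk (walkEnd (walkEnd (emb y) (stairWord i.2.1 (off i.1))) (List.replicate (s + 1) (μ, true) ++ List.replicate t (ν, true)))
          [((ν, true) : Letter P.d), (μ, false), (ν, false), (μ, true)])‖ =
      ∑ s ∈ Finset.range P.L, ∑ t ∈ Finset.range P.L,
        ‖covWalkSum U₀ (fun b => ((X b : (specialUnitaryLogChart (Fin N)).lie) : Matrix (Fin N) (Fin N) ℂ))
          (walk (walkEnd (walkEnd (emb y) (stairWord i.2.1 (off i.1))) (List.replicate (s + 1) (μ, true) ++ List.replicate t (ν, true)))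
          [((ν, true) : Letter P.d), (μ, false), (ν, false), (μ, true)])‖ := by
    intro i _
    refine Finset.sum_congr rfl fun s hs => Finset.sum_congr rfl fun t ht => ?_
    rw [covWalkSum_plaq'_congr_of_corner hj U₀ y hμν hagree' i (Finset.mem_range.1 hs) (Finset.mem_range.1 ht)]
  rw [Finset.sum_congr rfl hdil] at hC
  -- monotonicity in the size
  have hX'0 : 0 ≤ ‖X'‖ := norm_nonneg _
  have hℓ : 0 ≤ (((P.d + 2) * P.L : ℕ) : ℝ) := Nat.cast_nonneg _
  have hL : 0 ≤ (P.L : ℝ) := Nat.cast_nonneg _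
  have m1 : (P.L : ℝ) * ((P.L : ℝ) * (2 * δ * ((P.L : ℝ) + 2 * P.L + 2) * ‖X'‖)) ≤ (P.L : ℝ) * ((P.L : ℝ) * (2 * δ * ((P.L : ℝ) + 2 * P.L + 2) * M)) := by gcongr
  have m2 : 48 * α * ((P.L : ℝ) * ‖X'‖) ≤ 48 * α * ((P.L : ℝ) * M) := by gcongr
  have m3 : 2 * αp * ((((P.d + 2) * P.L : ℕ) : ℝ) * ‖X'‖) ≤ 2 * αp * ((((P.d + 2) * P.L : ℕ) : ℝ) * M) := by gcongr
  have m4 : 24 * α * ((((P.d + 2) * P.L : ℕ) : ℝ) * ‖X'‖) ≤ 24 * α * ((((P.d + 2) * P.L : ℕ) : ℝ) * M) := by gcongr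
  have m5 : 4 * (404 * (((P.d + 2) * P.L : ℕ) : ℝ) * α * ‖X'‖) ≤ 4 * (404 * (((P.d + 2) * P.L : ℕ) : ℝ) * α * M) := by gcongr
  have m6 : 4 * ((448000 / ρ ^ 2 + 172800 / ρ) * (((P.d + 2) * P.L : ℕ) : ℝ) ^ 2 * ‖X'‖ ^ 2) ≤ 4 * ((448000 / ρ ^ 2 + 172800 / ρ) * (((P.d + 2) * P.L : ℕ) : ℝ) ^ 2 * M ^ 2) := by
    have hρ' : 0 ≤ 448000 / ρ ^ 2 + 172800 / ρ := by positivity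
    gcongr
  linarith

/-- ★★★ **(CURL-AVG) FOR `ψ_{U₀}(X)`, LOCAL EDITION, `SU(2)`** (`α ≤ 1∕24`; no radius): C ✓`norm_curl_chartRead_le_SU2` with `‖X‖` replaced by any `M ≥ 0` bounding `‖X b‖` on the corner bonds of `p′`.
[cite: Balaban1985Averaging, Prop. 1 (51) p.26, Prop. 3 (121)-(126) p.36; Balaban1987RG1, (0.4), (0.8) p.253] -/
theorem norm_curl_chartRead_le_local_SU2 (hj : j + 1 ≤ P.m + P.K) (U₀ : GaugeField P j (SU 2)) {α : ℝ} (hα : ∀ (c : PBond P (j + 1)) (i : Idx P), dist1 (loopHol U₀ c i) ≤ α)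
    (hα24 : α ≤ 1 / 24) (hαδ : α < deltaSU (Fin 2)) {δ : ℝ} (hδ : 0 ≤ δ) (hU : PlaqSmall δ U₀) (y : Site P (j + 1)) {μ ν : Fin P.d} (hμν : μ ≠ ν) {αp : ℝ}
    (hαp : dist1 (holAt (avgFun (expMeanLogSU (n := Fin 2)) U₀) (walk y [((μ, true) : Letter P.d), (ν, true), (μ, false), (ν, false)])) ≤ αp)
    (X : PBond P j → (specialUnitaryLogChart (Fin 2)).lie) {M : ℝ} (hM : 0 ≤ M)
    (hXM : ∀ b : PBond P j, (blockOf b.src = y ∨ blockOf b.src = y.shift μ ∨ blockOf b.src = y.shift ν ∨ blockOf b.src = (y.shift μ).shift ν) → ‖X b‖ ≤ M) :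
    ‖covWalkSum (avgFun (expMeanLogSU (n := Fin 2)) U₀)
        (fun c : PBond P (j + 1) => (((isChartRep_specialUnitaryGroup (n := Fin 2)).logChart
            (avgFun (expMeanLogSU (n := Fin 2)) (fun b => (isChartRep_specialUnitaryGroup (n := Fin 2)).expChart (X b) * U₀ b) c *
              (avgFun (expMeanLogSU (n := Fin 2)) U₀ c)⁻¹) : (specialUnitaryLogChart (Fin 2)).lie) : Matrix (Fin 2) (Fin 2) ℂ))
        (walk y [((μ, true) : Letter P.d), (ν, true), (μ, false), (ν, false)])‖ ≤
      (Fintype.card (Idx P) : ℝ)⁻¹ * ∑ i : Idx P, ∑ s ∈ Finset.range P.L, ∑ t ∈ Finset.range P.L,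
          ‖covWalkSum U₀ (fun b => ((X b : (specialUnitaryLogChart (Fin 2)).lie) : Matrix (Fin 2) (Fin 2) ℂ))
            (walk (walkEnd (walkEnd (emb y) (stairWord i.2.1 (off i.1))) (List.replicate (s + 1) (μ, true) ++ List.replicate t (ν, true)))
            [((ν, true) : Letter P.d), (μ, false), (ν, false), (μ, true)])‖ +
        (P.L : ℝ) * ((P.L : ℝ) * (2 * δ * ((P.L : ℝ) + 2 * P.L + 2) * M)) + 48 * α * ((P.L : ℝ) * M) +
        (2 * αp * ((((P.d + 2) * P.L : ℕ) : ℝ) * M) + 24 * α * ((((P.d + 2) * P.L : ℕ) : ℝ) * M)) +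
        4 * (404 * (((P.d + 2) * P.L : ℕ) : ℝ) * α * M) + 4 * (4550400 * (((P.d + 2) * P.L : ℕ) : ℝ) ^ 2 * M ^ 2) := by
  classical
  set X' : PBond P j → (specialUnitaryLogChart (Fin 2)).lie := fun b =>
    if (blockOf b.src = y ∨ blockOf b.src = y.shift μ ∨ blockOf b.src = y.shift ν ∨ blockOf b.src = (y.shift μ).shift ν) then X b else 0 with hX'
  have hagree : ∀ b : PBond P j, (blockOf b.src = y ∨ blockOf b.src = y.shift μ ∨ blockOf b.src = y.shift ν ∨ blockOf b.src = (y.shift μ).shift ν) → X b = X' b := by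
    intro b hb; simp only [hX', hb, if_true]
  have hagree' : ∀ b : PBond P j, (blockOf b.src = y ∨ blockOf b.src = y.shift μ ∨ blockOf b.src = y.shift ν ∨ blockOf b.src = (y.shift μ).shift ν) →
      (fun b => ((X' b : (specialUnitaryLogChart (Fin 2)).lie) : Matrix (Fin 2) (Fin 2) ℂ)) b = (fun b => ((X b : (specialUnitaryLogChart (Fin 2)).lie) : Matrix (Fin 2) (Fin 2) ℂ)) b := by
    intro b hb; simp only [← hagree b hb]
  have hnorm : ‖X'‖ ≤ M := norm_truncCorner_le hM hXM
  have hα0 : 0 ≤ α := (GaugeGroup.dist1_nonneg _).trans (hα ⟨y, μ⟩ (Classical.arbitrary _))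
  have hαp0 : 0 ≤ αp := (GaugeGroup.dist1_nonneg _).trans hαp
  have hC := norm_curl_chartRead_le_SU2 U₀ hα hα24 hαδ hδ hU y μ ν hαp X'
  rw [← curl_chartRead_congr_of_corner hj U₀ (A := X) (A' := X') y μ ν hagree] at hC
  have hdil : ∀ i ∈ (Finset.univ : Finset (Idx P)), ∑ s ∈ Finset.range P.L, ∑ t ∈ Finset.range P.L,
        ‖covWalkSum U₀ (fun b => ((X' b : (specialUnitaryLogChart (Fin 2)).lie) : Matrix (Fin 2) (Fin 2) ℂ))
          (walk (walkEnd (walkEnd (emb y) (stairWord i.2.1 (off i.1))) (List.replicate (s + 1) (μ, true) ++ List.replicate t (ν, true)))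
          [((ν, true) : Letter P.d), (μ, false), (ν, false), (μ, true)])‖ =
      ∑ s ∈ Finset.range P.L, ∑ t ∈ Finset.range P.L,
        ‖covWalkSum U₀ (fun b => ((X b : (specialUnitaryLogChart (Fin 2)).lie) : Matrix (Fin 2) (Fin 2) ℂ))
          (walk (walkEnd (walkEnd (emb y) (stairWord i.2.1 (off i.1))) (List.replicate (s + 1) (μ, true) ++ List.replicate t (ν, true)))
          [((ν, true) : Letter P.d), (μ, false), (ν, false), (μ, true)])‖ := by
    intro i _
    refine Finset.sum_congr rfl fun s hs => Finset.sum_congr rfl fun t ht => ?_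
    rw [covWalkSum_plaq'_congr_of_corner hj U₀ y hμν hagree' i (Finset.mem_range.1 hs) (Finset.mem_range.1 ht)]
  rw [Finset.sum_congr rfl hdil] at hC
  have hX'0 : 0 ≤ ‖X'‖ := norm_nonneg _
  have hℓ : 0 ≤ (((P.d + 2) * P.L : ℕ) : ℝ) := Nat.cast_nonneg _
  have hL : 0 ≤ (P.L : ℝ) := Nat.cast_nonneg _
  have m1 : (P.L : ℝ) * ((P.L : ℝ) * (2 * δ * ((P.L : ℝ) + 2 * P.L + 2) * ‖X'‖)) ≤ (P.L : ℝ) * ((P.L : ℝ) * (2 * δ * ((P.L : ℝ) + 2 * P.L + 2) * M)) := by gcongr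
  have m2 : 48 * α * ((P.L : ℝ) * ‖X'‖) ≤ 48 * α * ((P.L : ℝ) * M) := by gcongr
  have m3 : 2 * αp * ((((P.d + 2) * P.L : ℕ) : ℝ) * ‖X'‖) ≤ 2 * αp * ((((P.d + 2) * P.L : ℕ) : ℝ) * M) := by gcongr
  have m4 : 24 * α * ((((P.d + 2) * P.L : ℕ) : ℝ) * ‖X'‖) ≤ 24 * α * ((((P.d + 2) * P.L : ℕ) : ℝ) * M) := by gcongr
  have m5 : 4 * (404 * (((P.d + 2) * P.L : ℕ) : ℝ) * α * ‖X'‖) ≤ 4 * (404 * (((P.d + 2) * P.L : ℕ) : ℝ) * α * M) := by gcongr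
  have m6 : 4 * (4550400 * (((P.d + 2) * P.L : ℕ) : ℝ) ^ 2 * ‖X'‖ ^ 2) ≤ 4 * (4550400 * (((P.d + 2) * P.L : ℕ) : ℝ) ^ 2 * M ^ 2) := by gcongr
  linarith

end Local

end Summit.QuantumFields.YangMills.Theorems.FluctuationComparisonRegPrIntLS2BetaCoarseCurlLocal

end
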